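import Summits.BirchSwinnertonDyer.Rank1Residual.Supersingular.GoodThreeKimLargeImageOPEN
import Summits.BirchSwinnertonDyer.Rank1Residual.X4.KimTamagawaDefectUpper
import Summits.BirchSwinnertonDyer.Rank1Residual.X4.KimShaLengthFiveLe
import Summits.BirchSwinnertonDyer.Rank1Residual.Additive.X4KimLargeImageIntegralPeriod
import Summits.BirchSwinnertonDyer.Rank1Residual.Additive.PlusSymbolIntegrality
import HarnessLib

/-!
# Good `3` with the `3`-adic tower (class X8 = N6, and X7@3 / X6@3), analytic rank ZERO: the TAMAGAWA
# DEFECT of the Kurihara numbers at `3` — `∂^{(∞)}(δ̃) ≥ ord₃ ∏ c_ℓ` from Wuthrich's PUBLISHED upper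
# bound, CONDITIONAL on the announced Kim 2025 (arXiv:2505.09121, PREPRINT) structure clause
# (cell `b2b-bsdres`, supersingular family, prover B = unit `b2b-bsdres-additive-p3`, gen 18; CLASS-CLOSURE
# §3.12, class N6 = X8 ∧ `r = 0`, class lead additive-p3; FILE 1 of 2 — the exact boundary
# `BSD(E,3) ⟺ ∂^{(∞)}(δ̃) ≤ ord₃ ∏ c_ℓ` and the level-`3^{t+1}` certificate are FILE 2,
# `Supersingular/X8KimTamagawaDefectOPEN.lean`)

HONEST FRAMING (run/shared/lean/b2b/bsd-rank1-residual/, verbatim in every file): the goal of the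
cell is to DELETE the COMBINATION-SHAPED residual classes of the Birch–Swinnerton-Dyer formula for
ALL analytic-rank `≤ 1` elliptic curves over `ℚ` — "full BSD formula for every rank `≤ 1` curve in
class `C`" assembled STRICTLY from published theorems — so that the rank-`≤ 1` remainder becomes
exactly the CONSTRUCTION-SHAPED classes, which are TYPED (missing-input `Prop`s), NOT attempted.
This is not "finishing BSD". Research route; no claim beyond the stated classes. X8 / X7 / X6 stay
CONSTRUCTION-SHAPED; per pair only; nothing about any curve is asserted; nothing is booked; no mark
of RESIDUAL-MAP §I (N4–N6 / O3–O4) moves. An ANNOUNCED preprint enters ONLY as an explicitly labelled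
OPEN hypothesis: every theorem below carrying `hK25s : Kim2025.thm11_kimShaLength_of_integralPeriod_OPEN`
is CONDITIONAL on the unrefereed arXiv:2505.09121v1 (C.-H. Kim, appendix with R. Pollack, *The
refined Tamagawa number conjectures for `GL₂`*, 2025; Thm. 1.1 ("BSD") second clause, typed in the
tree's `∂`-vocabulary by n1011-p09, `Kim2025/StructureClauseOPEN.lean`); its `p = 3` Kolyvagin-system
input, R. Sakamoto, J. Théor. Nombres Bordeaux 36 (2024) 919–946, IS refereed. Theorems only (pure
compositions of tree theorems BY NAME); no definition, no named fact (debt 0).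

## What is proved

Notation: `t = ord₃ ∏_ℓ c_ℓ(E)` (`padicValNat 3 W.tamagawaProduct`), `δ̃` = the collection of
`Ω⁺_f`-normalised Kurihara numbers of the newform `f = D.f` over the CYCLIC Kolyvagin levels
(`KuriharaNumberInvariants`: `∂^{(i)} = kuriharaPartial`, `∂^{(∞)} = kuriharaPartialInfty`); Kim's
Conjecture 1.10 at the pair = n1011's typed items `X4.KimTamagawaDefectAt W 3 f` (`∂^{(∞)} = t`),
`…LeAt` (`∂^{(∞)} ≤ t`), `…GeAt` (`t ≤ ∂^{(∞)}`) of `X4/KimTamagawaDefect.lean` (class-agnostic predicates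
despite the `X4.` prefix). Standing hypotheses of §1–§2: GOOD reduction at `3`, analytic rank `0`, the
`3`-adic TOWER `∀ n, ρ̄_{E,3^n}` onto (a HYPOTHESIS here; on X8 it is fed by gen 16's certificates
(ram@3) / semistability + level-lowering / one Frobenius mod `9` — FILE 2 §4), a modular
parametrisation datum `D` (only its newform `D.f` is used — NO Manin binder: the `Ω⁺_f`-integrality
of every plus symbol is n1011-p09's THEOREM `forall_padicValRat_ratPlusSymbol_nonneg_of_towerSurj`,
Drinfeld–Manin made `3`-integral), the period transfer `Ω(W) = u·Ω⁺_f`, `|u|₃ = 1` = the PUBLISHED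
named fact `h3per` (`realPeriodRat_eq_unit_mul_plusPeriod_three`: Greenberg–Vatsal 2000 Rem. 3.4 +
Mazur 1978 + Edixhoven 1991 at a good `3` with `E[3]` irreducible — automatic from the tower), GZK
`hGZK`, modularity `hmod`.

* §0 (fact-free, any `p`): ONE non-zero `δ̃_n^{(k)}` at a cyclic level gives `∂^{(∞)} ≤ k − 1`. (On a
  rank-`0` Kim witness `(q, d)` — `L(E,1)/Ω(W) = q`, `ord_p q = ord_p #Ш(E/ℚ)(p) + d`, `d = ∂^{(∞)}(δ̃)` —
  `MissingUpperBoundAt W p ⟺ t ≤ d` and `MissingLowerBoundAt W p ⟺ d ≤ t`: additive-p4's fact-free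
  iffs of `X4/KimShaLengthFiveLe.lean`, reused by name.)
* §1 (OPEN input `hK25s`): the witness `X4.KimShaLengthRankZeroAt W 3 D.f` at a good `3` under the
  tower (`GoodThree.kimShaLengthRankZeroAt_of_kim2025_OPEN`), NO Manin binder.
* §2 **THE TAMAGAWA DEFECT** (`hK25s` OPEN + Wuthrich 2014 Prop. 21 `hW` PUBLISHED — its constant `C`
  is a `3`-adic unit at a good `3` with `ρ̄_{E,3}` onto): `X4.KimTamagawaDefectGeAt W 3 D.f`, i.e.
  `∂^{(∞)}(δ̃) ≥ t`; hence EVERY Kurihara number at EVERY cyclic level `n ∈ 𝒩_k` with `k ≤ t`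
  vanishes modulo `3^k` (`KuriharaDivisibleAt … n t`), NO unit Kurihara number exists on a `3 ∣ ∏ c_ℓ`
  row (gen 17's `X8RankZero.not_kuriharaUnitAt_…_of_bsdp_of_dvd_tamagawaProduct` WITHOUT its `BSD(E,3)`
  hypothesis), and a non-zero `δ̃_n^{(k)}` forces `t < k`. This is Kim's Conjecture 1.10 `≥` half at
  `(E, 3)` on these rows, modulo the preprint — the instrument regularity of the census (hyp
  `hyp/x8r0/X8R0-UPSET.md` §1: on the 52 window CORE pairs of X8 ∧ `r = 0` a unit exists iff surj(3)
  ∧ `3 ∤ ∏c`; the Tamagawa pairs 9950f1, 12155c1, 17200bj1, 18515u1 have `δ̃ ≡ 0` at every level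
  tried) READ AS A CONDITIONAL THEOREM. Compare n1011's `p ≥ 5` `X4/KimTamagawaDefectUpper.lean`, which
  goes the OTHER way (`≥` half ⟹ upper bound) because at an additive prime no published upper bound
  exists; at the GOOD prime `3` Wuthrich supplies it and the `≥` half FOLLOWS.

NOT claimed: no class theorem; nothing about the `3Nn` rows (no tower); nothing in analytic rank `1`
(O3: there Wuthrich's Prop. 21 is void and the `≥` half has no published substitute).

References: [Kim2025RefinedTNC] Thm. 1.1 ("BSD"), Cor. 1.7, §1.4.4, §8.1.2 (ANNOUNCED, OPEN binder);
[Sakamoto2024KolyvaginThree] Thm. 1.1; [Kim2022StructureSelmer] Thm. 1.9 (6), §1.5.1, Conj. 1.10,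
Def. 2.13; [Wuthrich2014] Prop. 21 (p. 400); [GreenbergVatsal2000] Rem. 3.4; [Mazur1978] Cor. 4.1;
[Serre1972] Prop. 12; [Miller2011LMS] Def. 1.1; HOME class-closure/N6/STATEMENT.md,
WEEK-2026-08-28.md §10; hyp `hyp/x8r0/X8R0-UPSET.md`.
-/
noncomputable section

open scoped Classical MatrixGroups ModularForm

open CongruenceSubgroup WeierstrassCurve Literature.NumberTheory.EllipticCurves
  Literature.NumberTheory.EllipticCurves.ModularForms
  Literature.NumberTheory.EllipticCurves.Rank1Residual
  Literature.NumberTheory.EllipticCurves.Rank1Residual.Typed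
  Literature.NumberTheory.EllipticCurves.Wuthrich2014
  Summit.BirchSwinnertonDyer.Rank1Residual.Additive

namespace Summit.BirchSwinnertonDyer.Rank1Residual.Supersingular

/-! ### §0 Fact-free bookkeeping (any prime `p`): ONE non-zero Kurihara number modulo `p^k` bounds
`∂^{(∞)}(δ̃)` by `k − 1` (the two halves of the `p`-part on a rank-`0` Kim witness `(q, d)` —
`MissingUpperBoundAt ⟺ t ≤ d`, `MissingLowerBoundAt ⟺ d ≤ t` — are additive-p4's
`X4.missingUpperBoundAt_iff_tamagawa_le_of_rankZero_witness` /
`X4.missingLowerBoundAt_iff_le_tamagawa_of_rankZero_witness`, file `X4/KimShaLengthFiveLe.lean`, imported) -/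

section Witness

variable (W : WeierstrassCurve ℚ) [W.IsElliptic] [W.IsGloballyMinimal] (p : ℕ) [hp : Fact p.Prime]

omit [W.IsElliptic] hp in
/-- **A Kurihara number NON-ZERO modulo `p^k` at a level `n ∈ 𝒩_k` has divisibility index `≤ k − 1`**
(Kim §1.5.1 / Def. 2.13). Private copy of n1011's `Additive.kuriharaDivIndex_le_of_kuriharaNumber_ne_zero`
(file `Additive/X4RankOneKimPartialShape.lean`, same statement and proof; that module's imports are not
wanted here). [cite: Kim2022StructureSelmer, §1.5.1 (PDF p. 7), Def. 2.13 (PDF p. 14)] -/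
private theorem kuriharaDivIndex_le_pred_of_ne_zero {N : ℕ} (f : CuspForm (Gamma0 N) 2) {n k : ℕ}
    [NeZero n] (hn : Kato.IsKolyvaginProduct W p k n)
    (ψ : (ℓ : ℕ) → (ZMod ℓ)ˣ →* Multiplicative (ZMod (p ^ k)))
    (hψ : ∀ ℓ ∈ n.primeFactors, Function.Surjective (ψ ℓ))
    (hne : kuriharaNumber f (p ^ k) n ψ ≠ 0) :
    kuriharaDivIndex W p f n ≤ ((k - 1 : ℕ) : ℕ∞) := by
  rw [kuriharaDivIndex_def]
  refine iSup₂_le fun j hj => ?_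
  by_cases hjk : k ≤ j
  · exact absurd (hj k hjk hn ψ hψ) hne
  · exact_mod_cast (by omega : j ≤ k - 1)

omit [W.IsElliptic] hp in
/-- **ONE non-zero `δ̃_n^{(k)}` at a cyclic level bounds the defect: `∂^{(∞)}(δ̃) ≤ k − 1`.**
[cite: Kim2022StructureSelmer, §1.5.1 (PDF p. 7), Def. 2.13 (PDF p. 14)] -/
theorem kuriharaPartialInfty_le_pred_of_ne_zero {N : ℕ} (f : CuspForm (Gamma0 N) 2) {n k : ℕ}
    [NeZero n] (hcyc : IsCyclicKolyvaginLevel W p n) (hn : Kato.IsKolyvaginProduct W p k n)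
    (ψ : (ℓ : ℕ) → (ZMod ℓ)ˣ →* Multiplicative (ZMod (p ^ k)))
    (hψ : ∀ ℓ ∈ n.primeFactors, Function.Surjective (ψ ℓ))
    (hne : kuriharaNumber f (p ^ k) n ψ ≠ 0) :
    kuriharaPartialInfty W p f ≤ ((k - 1 : ℕ) : ℕ∞) :=
  ((kuriharaPartialInfty_le W p f _).trans (kuriharaPartial_le W p f hcyc rfl)).trans
    (kuriharaDivIndex_le_pred_of_ne_zero W p f hn ψ hψ hne)

end Witness

/-! ### §1 The rank-`0` Kim witness at a GOOD `3` under the `3`-adic tower (OPEN input `hK25s`),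
with NO Manin binder -/

section GoodThree

variable (W : WeierstrassCurve ℚ) [W.IsElliptic] [W.IsGloballyMinimal]

omit [W.IsGloballyMinimal] in
/-- Under the `3`-adic tower, `ρ̄_{E,3}` is onto and `E[3]` is irreducible. Bookkeeping. [folklore] -/
theorem GoodThree.surj_and_irr_of_tower (htower : ∀ n : ℕ, W.HasSurjectiveModNGaloisRep (3 ^ n : ℕ)) :
    Surj W 3 ∧ Irr W 3 := by
  have hs : W.HasSurjectiveModNGaloisRep 3 := by simpa using htower 1
  exact ⟨hs, hasIrreducibleModPGaloisRep_of_hasSurjectiveModNGaloisRep W 3 hs⟩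

/-- **The rank-`0` Kim witness at a good `3` under the tower, NO Manin binder**: good reduction at `3`,
`r_an = 0`, `∀ n, ρ̄_{E,3^n}` onto, a parametrisation datum `D` (newform `D.f`) ⟹
`X4.KimShaLengthRankZeroAt W 3 D.f` — `L(E,1)/Ω(W) = q`, `∂^{(∞)}(δ̃) = d ∈ ℕ`,
`ord₃ q = ord₃ #Ш(E/ℚ)(3) + d` —, CONDITIONAL on Kim 2025 Thm. 1.1 ("BSD") second clause (`hK25s`,
OPEN). Discharged binders: `Ш` finite (GZK), `Ω⁺_f`-integrality of every plus symbol (n1011-p09's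
`forall_padicValRat_ratPlusSymbol_nonneg_of_towerSurj`, Drinfeld–Manin), the period transfer at `3`
(`h3per`, PUBLISHED: good `3`, `E[3]` irreducible). Class-agnostic (X8, X7@3, X6@3, good ordinary `3`
alike); per pair. [claim: Kim2025RefinedTNC, status: under-review]
[cite: Kim2025RefinedTNC, Thm. 1.1 ("BSD"), Cor. 1.7, §1.4.4 (ANNOUNCED, OPEN binder)]
[cite: Sakamoto2024KolyvaginThree, Thm. 1.1 = Thm. 4.4 (p. 920)] [cite: GreenbergVatsal2000, §3, Remark 3.4] -/
theorem GoodThree.kimShaLengthRankZeroAt_of_kim2025_OPEN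
    (hK25s : Kim2025.thm11_kimShaLength_of_integralPeriod_OPEN)
    (hGZK : rank_eq_analyticRank_of_analyticRank_le_one) (hmod : hasEntireLFunction_rat)
    (h3per : realPeriodRat_eq_unit_mul_plusPeriod_three)
    (hgood : W.HasGoodReductionAtPrime 3) (hr : W.analyticRank = 0)
    (htower : ∀ n : ℕ, W.HasSurjectiveModNGaloisRep (3 ^ n : ℕ))
    {N : ℕ} [NeZero N] (D : ModularParametrizationData W N) :
    X4.KimShaLengthRankZeroAt W 3 D.f := by
  have hL : W.entireLFunction 1 ≠ 0 := (W.analyticRank_eq_zero_iff_holds (hmod W)).mp hr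
  have hfin : Finite W.sha := (hGZK W (by rw [hr]; exact zero_le_one)).2
  have hirr : Irr W 3 := (GoodThree.surj_and_irr_of_tower W htower).2
  exact Additive.kimShaLengthRankZeroAt_of_kim2025_OPEN W 3 hK25s le_rfl htower hL hfin D
    (GoodThree.periodTransfer W h3per hgood hirr D.f D.isNewformOf)
    (forall_padicValRat_ratPlusSymbol_nonneg_of_towerSurj (by decide) D.isNewformOf htower)

/-! ### §2 THE TAMAGAWA DEFECT: `∂^{(∞)}(δ̃) ≥ ord₃ ∏ c_ℓ` from Wuthrich's PUBLISHED upper bound -/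

/-- **Wuthrich's Prop. 21 at a good `3` under the tower: `MissingUpperBoundAt W 3`** (`ord₃ #Ш ≤
ord₃ #Ш_an`; the printed constant `C` is supported at `2`, additive primes and exotic-image primes —
`3` is good, hence not additive, and `ρ̄_{E,3}` is onto). PUBLISHED input `hW`; GZK; modularity.
[cite: Wuthrich2014, Prop. 21 (p. 400)] [cite: Miller2011LMS, Def. 1.1] -/
theorem GoodThree.missingUpperBoundAt_of_wuthrich (hW : sha_dvd_analyticSha)
    (hGZK : rank_eq_analyticRank_of_analyticRank_le_one) (hmod : hasEntireLFunction_rat)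
    (hgood : W.HasGoodReductionAtPrime 3) (hr : W.analyticRank = 0)
    (htower : ∀ n : ℕ, W.HasSurjectiveModNGaloisRep (3 ^ n : ℕ)) : MissingUpperBoundAt W 3 := by
  have hadd : ¬ ((W.baseChange ℚ_[3]).minimal ℤ_[3]).HasAdditiveReduction ℤ_[3] :=
    WeierstrassCurve.HasGoodReduction.not_hasAdditiveReduction (R := ℤ_[3]) hgood
  exact Typed.missingUpperBoundAt_of_wuthrich W 3 hW hGZK hmod (by decide) hr hadd
    (Or.inr (GoodThree.surj_and_irr_of_tower W htower).1)

/-- **THE TAMAGAWA DEFECT AT A GOOD `3` UNDER THE TOWER, analytic rank `0`**: `∂^{(∞)}(δ̃) ≥ ord₃ ∏ c_ℓ`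
— the typed `≥` half `X4.KimTamagawaDefectGeAt W 3 D.f` of Kim's Conjecture 1.10 at the pair —,
from Kim 2025 Thm. 1.1 second clause (`hK25s`, OPEN) and Wuthrich 2014 Prop. 21 (`hW`, PUBLISHED):
the witness gives `ord₃ #Ш_an = ord₃ #Ш + ∂^{(∞)} − t`, Wuthrich gives `ord₃ #Ш ≤ ord₃ #Ш_an`. CONDITIONAL
on the preprint; per pair; NOT a class theorem. [claim: Kim2025RefinedTNC, status: under-review]
[cite: Kim2025RefinedTNC, Thm. 1.1 ("BSD"), Cor. 1.7 (ANNOUNCED, OPEN binder)] [cite: Wuthrich2014, Prop. 21 (p. 400)]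
[cite: Kim2022StructureSelmer, Conj. 1.10 (§1.5.3, PDF p. 8)] -/
theorem GoodThree.kimTamagawaDefectGeAt_of_kim2025_OPEN_of_wuthrich
    (hK25s : Kim2025.thm11_kimShaLength_of_integralPeriod_OPEN) (hW : sha_dvd_analyticSha)
    (hGZK : rank_eq_analyticRank_of_analyticRank_le_one) (hmod : hasEntireLFunction_rat)
    (h3per : realPeriodRat_eq_unit_mul_plusPeriod_three)
    (hgood : W.HasGoodReductionAtPrime 3) (hr : W.analyticRank = 0)
    (htower : ∀ n : ℕ, W.HasSurjectiveModNGaloisRep (3 ^ n : ℕ))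
    {N : ℕ} [NeZero N] (D : ModularParametrizationData W N) :
    X4.KimTamagawaDefectGeAt W 3 D.f := by
  obtain ⟨q, d, hq, hd, hval⟩ :=
    GoodThree.kimShaLengthRankZeroAt_of_kim2025_OPEN W hK25s hGZK hmod h3per hgood hr htower D
  have hL : W.entireLFunction 1 ≠ 0 := (W.analyticRank_eq_zero_iff_holds (hmod W)).mp hr
  obtain ⟨hmw, hfin⟩ := hGZK W (by rw [hr]; exact zero_le_one)
  have hirr : Irr W 3 := (GoodThree.surj_and_irr_of_tower W htower).2
  have htd : padicValNat 3 W.tamagawaProduct ≤ d :=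
    (X4.missingUpperBoundAt_iff_tamagawa_le_of_rankZero_witness W 3 hmw hfin hL hirr hq hval).mp
      (GoodThree.missingUpperBoundAt_of_wuthrich W hW hGZK hmod hgood hr htower)
  unfold X4.KimTamagawaDefectGeAt
  rw [hd]
  exact_mod_cast htd

/-- **Every Kurihara number at every cyclic level is divisible by `3^{ord₃ ∏ c_ℓ}`** (good `3`, tower,
`r_an = 0`): `KuriharaDivisibleAt W 3 D.f n t` for every cyclic Kolyvagin level `n` — for every `k ≤ t`
with `n ∈ 𝒩_k` and every surjective `ψ`, `kuriharaNumber D.f (3^k) n ψ = 0`. CONDITIONAL on `hK25s`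
(OPEN) + `hW` (PUBLISHED). The census regularity "`δ̃ ≡ 0` at every level tried on the Tamagawa rows"
(hyp X8R0-UPSET §1; cc-eng-6 KURX profiles) as a conditional theorem. Per pair.
[claim: Kim2025RefinedTNC, status: under-review] [cite: Kim2025RefinedTNC, Thm. 1.1, §8.1.2 (ANNOUNCED, OPEN binder)]
[cite: Wuthrich2014, Prop. 21 (p. 400)] [cite: Kim2022StructureSelmer, §1.5.1 (PDF p. 7), Conj. 1.10 (PDF p. 8)] -/
theorem GoodThree.kuriharaDivisibleAt_tamagawa_of_kim2025_OPEN_of_wuthrich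
    (hK25s : Kim2025.thm11_kimShaLength_of_integralPeriod_OPEN) (hW : sha_dvd_analyticSha)
    (hGZK : rank_eq_analyticRank_of_analyticRank_le_one) (hmod : hasEntireLFunction_rat)
    (h3per : realPeriodRat_eq_unit_mul_plusPeriod_three)
    (hgood : W.HasGoodReductionAtPrime 3) (hr : W.analyticRank = 0)
    (htower : ∀ n : ℕ, W.HasSurjectiveModNGaloisRep (3 ^ n : ℕ))
    {N : ℕ} [NeZero N] (D : ModularParametrizationData W N)
    {n : ℕ} (hcyc : IsCyclicKolyvaginLevel W 3 n) :
    KuriharaDivisibleAt W 3 D.f n (padicValNat 3 W.tamagawaProduct) :=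
  Kim2026.kuriharaDivisibleAt_of_le_kuriharaPartialInfty W 3 D.f
    (GoodThree.kimTamagawaDefectGeAt_of_kim2025_OPEN_of_wuthrich W hK25s hW hGZK hmod h3per hgood hr
      htower D) hcyc

/-- **A non-zero Kurihara number modulo `3^k` at a cyclic level forces `ord₃ ∏ c_ℓ < k`** (good `3`,
tower, `r_an = 0`): the level of any certificate is at least `t + 1`. CONDITIONAL on `hK25s` (OPEN) +
`hW` (PUBLISHED). Per pair. [claim: Kim2025RefinedTNC, status: under-review]
[cite: Kim2025RefinedTNC, Thm. 1.1 (ANNOUNCED, OPEN binder)] [cite: Wuthrich2014, Prop. 21 (p. 400)]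
[cite: Kim2022StructureSelmer, §1.5.1 (PDF p. 7)] -/
theorem GoodThree.tamagawa_lt_level_of_kuriharaNumber_ne_zero_of_kim2025_OPEN_of_wuthrich
    (hK25s : Kim2025.thm11_kimShaLength_of_integralPeriod_OPEN) (hW : sha_dvd_analyticSha)
    (hGZK : rank_eq_analyticRank_of_analyticRank_le_one) (hmod : hasEntireLFunction_rat)
    (h3per : realPeriodRat_eq_unit_mul_plusPeriod_three)
    (hgood : W.HasGoodReductionAtPrime 3) (hr : W.analyticRank = 0)
    (htower : ∀ n : ℕ, W.HasSurjectiveModNGaloisRep (3 ^ n : ℕ))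
    {N : ℕ} [NeZero N] (D : ModularParametrizationData W N)
    {n k : ℕ} [NeZero n] (hcyc : IsCyclicKolyvaginLevel W 3 n) (hn : Kato.IsKolyvaginProduct W 3 k n)
    (ψ : (ℓ : ℕ) → (ZMod ℓ)ˣ →* Multiplicative (ZMod (3 ^ k)))
    (hψ : ∀ ℓ ∈ n.primeFactors, Function.Surjective (ψ ℓ))
    (hne : kuriharaNumber D.f (3 ^ k) n ψ ≠ 0) : padicValNat 3 W.tamagawaProduct < k := by
  have hge := GoodThree.kimTamagawaDefectGeAt_of_kim2025_OPEN_of_wuthrich W hK25s hW hGZK hmod h3per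
    hgood hr htower D
  have hle := kuriharaPartialInfty_le_pred_of_ne_zero W 3 D.f hcyc hn ψ hψ hne
  have hk : 1 ≤ k := by
    by_contra h0
    have hk0 : k = 0 := by omega
    subst hk0
    haveI : Subsingleton (ZMod (3 ^ 0)) := ZMod.subsingleton_iff.mpr (pow_zero 3)
    exact hne (Subsingleton.elim _ _)
  have : (padicValNat 3 W.tamagawaProduct : ℕ∞) ≤ ((k - 1 : ℕ) : ℕ∞) := hge.trans hle
  have h' : padicValNat 3 W.tamagawaProduct ≤ k - 1 := by exact_mod_cast this
  omega

/-- **NO UNIT Kurihara number on a `3 ∣ ∏ c_ℓ` row** (good `3`, tower, `r_an = 0`): additive-p3's typed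
input `X4.KuriharaUnitAt W 3 D.f` FAILS — every mod-`3` Kurihara number at every cyclic level of `𝒩₁`
vanishes. CONDITIONAL on `hK25s` (OPEN) + `hW` (PUBLISHED). This is gen 17's
`X8RankZero.not_kuriharaUnitAt_of_kim2025_OPEN_of_bsdp_of_dvd_tamagawaProduct` with its `BSD(E,3)`
hypothesis REMOVED (Wuthrich's upper bound replaces it). Per pair.
[claim: Kim2025RefinedTNC, status: under-review] [cite: Kim2025RefinedTNC, Thm. 1.1, §8.1.2 (ANNOUNCED, OPEN binder)]
[cite: Wuthrich2014, Prop. 21 (p. 400)] [cite: Kim2022StructureSelmer, Conj. 1.10 (PDF p. 8)] -/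
theorem GoodThree.not_kuriharaUnitAt_of_kim2025_OPEN_of_wuthrich_of_dvd_tamagawaProduct
    (hK25s : Kim2025.thm11_kimShaLength_of_integralPeriod_OPEN) (hW : sha_dvd_analyticSha)
    (hGZK : rank_eq_analyticRank_of_analyticRank_le_one) (hmod : hasEntireLFunction_rat)
    (h3per : realPeriodRat_eq_unit_mul_plusPeriod_three)
    (hgood : W.HasGoodReductionAtPrime 3) (hr : W.analyticRank = 0)
    (htower : ∀ n : ℕ, W.HasSurjectiveModNGaloisRep (3 ^ n : ℕ))
    {N : ℕ} [NeZero N] (D : ModularParametrizationData W N) (htam : 3 ∣ W.tamagawaProduct) :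
    ¬ X4.KuriharaUnitAt W 3 D.f :=
  X4.not_kuriharaUnitAt_of_kimTamagawaDefectGe_of_dvd W 3 D.f htam
    (GoodThree.kimTamagawaDefectGeAt_of_kim2025_OPEN_of_wuthrich W hK25s hW hGZK hmod h3per hgood hr
      htower D)

end GoodThree

end Summit.BirchSwinnertonDyer.Rank1Residual.Supersingular

end
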